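import Literature.NumberTheory.GaloisRepresentations.LubinTateComparisonPoints
import Literature.NumberTheory.GaloisRepresentations.LocalArtinMapPinned
import Literature.NumberTheory.GaloisRepresentations.LocalGaloisGroupFrobeniusProofs
import HarnessLib

/-!
# Lubin–Tate reciprocity: `χ_π = Art_F` on inertia (tree normalisation)

Topic `NumberTheory/GaloisRepresentations`; namespace `Literature.NumberTheory.GaloisRepresentations`.

**Theorem** (`coe_lubinTateChar_toAbsGalois`).  Let `F` be a non-archimedean local field, `π` a
uniformiser, `χ_π : Γ_F → 𝒪_Fˣ` the Lubin–Tate character of `f = πX + X^q`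
(`lubinTateChar`, file `LubinTateCharacterLimit.lean`: `σ λ = [χ_π(σ)]_f λ` on all `π`-power
division points), and `art : W_F →* Fˣ` ANY homomorphism with the characterising clauses
`IsLocalArtinMap F art` of the tree (Deligne's normalisation: degree-`-1` = geometric Frobenii go
to uniformisers; the finite-level norm clause).  Then for every `w` in the inertia subgroup of
`W_F`:  `χ_π(w) = art(w)`.

This is Lubin–Tate's explicit reciprocity law (Lubin–Tate 1965 Thm. 3 and its Corollary;
Cassels–Fröhlich VI §3.7 Thm. 3: with the ARITHMETIC normalisation `(u, F_π/F) = [u⁻¹]_f`), in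
the tree's geometric normalisation, where the sign disappears (consistent with the tree's named
fact `cyclotomicCharacter_artin_eq_norm`, the case `F = ℚ_ℓ`, `f ∼ (1+X)^ℓ - 1`).  In particular it
applies to THE pinned map `canonicalArtin F` under `isLocalArtinMap_canonicalArtin`.

Proof (Lubin–Tate, pp. 385–386, formalised over the preceding files
`LubinTateFrobeniusTwist` → `LubinTateComparison` → `LubinTateComparisonUnramified` →
`LubinTateComparisonPoints`): let `u = art(w) ∈ 𝒪_Fˣ`; choose `Φ ∈ W_F` of degree `-1` with
`art(Φ) = π` (`exists_deg_eq_neg_one_artin_eq`) and put `w' = wΦ`, so `art(w') = uπ =: π'` and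
`deg w' = -1`.  By the norm clause and `π = N(-λ_{n+1})` (`mem_range_norm_ltField`), `Φ` fixes
`K_π^{n+1}` and `w'` fixes `K_{π'}^{n+1}` pointwise.  Let `σ₀ = w'⁻¹|` (an arithmetic Frobenius),
`φ = galAut σ₀` on `𝒪̂_{F^nr}`, and `ϑ` the comparison series with `ϑ^φ = ϑ ∘ [u]_f`,
`ϑ ∘ [a]_f = [a]_{f'} ∘ ϑ`.  For `λ = λ_{n+1}` and `μ = ϑ(λ) ∈ 𝔪_ℂ`: `μ` is an `f'`-division point
of level `n+1`, hence algebraic and fixed by `w'`; Galois semilinearity gives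
`μ = w'μ = ϑ^{φ⁻¹}(w'λ) = ϑ([u⁻¹]_f (w'λ))`, so by injectivity of `ϑ` on `𝔪_ℂ`,
`w'λ = [u]_f λ`; and `w'λ = w(Φλ) = wλ`.  Comparing with `wλ = [χ_π(w)]_f λ` at every level `n`
gives `χ_π(w) ≡ u (mod π^{n+1})` for all `n`.

## References

* [LubinTate1965] J. Lubin, J. Tate, *Formal complex multiplication in local fields*, Ann. of
  Math. 81 (1965), Thm. 3 and Corollary, pp. 385–387.
* [CasselsFrohlichANT1967] J.-P. Serre, *Local class field theory* (Cassels–Fröhlich Ch. VI),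
  §3.7 Thm. 3.
* [SerreLocalFields1979] J.-P. Serre, *Local Fields*, Ch. XIII §4 Thm. 2, Prop. 13.
-/

noncomputable section

open MvPowerSeries

namespace Literature.NumberTheory.GaloisRepresentations

section Points

open ValuativeRel IsLocalRing Field IsNonarchimedeanLocalField LubinTate
open Literature.NumberTheory.PAdicHodge

variable {F : Type} [Field F] [ValuativeRel F] [TopologicalSpace F] [IsNonarchimedeanLocalField F]

/-! ### Lubin–Tate reciprocity in the tree's normalisation -/

section Reciprocity

-- the normed-field instances on `F` and on finite subextensions of `F̄` of `LubinTateTorsion.lean`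
attribute [local instance] instUniformSpace_literature rk1 nF nE

/-- (local) the uniform structure of `F` is a group uniformity. [folklore] -/
local instance recIsUniformAddGroup : IsUniformAddGroup F := isUniformAddGroup_of_addCommGroup

variable {π : 𝒪[F]} (hπ : (valuation F).IsUniformizer (π : F))

/-- `λ_{n+1} ∈ 𝔪_{K_π^{n+1}}` viewed in `𝔪_ℂ`. [folklore] -/
def genPtC (n : ℕ) : (maxNilIdealC F).toIdeal :=
  ⟨unitBallToCBall (ltField π n)
      ((genPt hπ n : (maxNilIdeal F (ltField π n)).toIdeal) : unitBall (ltField π n)),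
    unitBallToCBall_mem _ (genPt hπ n).2⟩

/-- The `[a]`-series over the two discrete copies of `𝒪_F` agree. [folklore] -/
theorem map_of_hom (a : 𝒪[F]) :
    PowerSeries.map (LTCoeff.of F).toRingHom
        (hom (isLTRing_integer F hπ) (isLTSeries_ltPoly F) (isLTSeries_ltPoly F) a) =
      hom (isLTRing_LTCoeff hπ) (isLTSeries_LTCoeff π) (isLTSeries_LTCoeff π) (LTCoeff.of F a) := by
  ext n
  rfl

/-- **Bridge**: `[a]_f λ_{n+1}` computed in `K_π^{n+1}` (`ltAct`) and in `ℂ_F` agree.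
[folklore] -/
theorem evalPt₁_homC_genPtC (n : ℕ) (a : 𝒪[F]) :
    evalPt₁ (maxNilIdealC F) (homC hπ a) (constantCoeff_homC hπ a) (genPtC hπ n) =
      ⟨unitBallToCBall (ltField π n)
          ((ltAct hπ n a (genPt hπ n) : (maxNilIdeal F (ltField π n)).toIdeal) : unitBall (ltField π n)),
        unitBallToCBall_mem _ (ltAct hπ n a (genPt hπ n)).2⟩ := by
  have h := unitBallToCBall_evalPt₁ (ltField π n)
    (hom (isLTRing_integer F hπ) (isLTSeries_ltPoly F) (isLTSeries_ltPoly F) a) (constantCoeff_hom _ _ _ a)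
    (genPt hπ n)
  apply Subtype.ext
  refine h.symm.trans ?_
  congr 2

/-- `[π^{n+1}]_f λ_{n+1} = 0`. [cite: CasselsFrohlichANT1967, Ch. VI §3.6 Prop. 6 (a)] -/
theorem ltAct_pow_succ_genPt (n : ℕ) : ltAct hπ n (π ^ (n + 1)) (genPt hπ n) = 0 := by
  rw [(ltAct_genPt_eq_iff hπ (b := 0)).mpr (by rw [sub_zero])]
  change ltSMul _ _ _ (LTCoeff.of F 0) _ = 0
  rw [map_zero]
  exact zero_ltSMul _ _ _ _

omit [TopologicalSpace F] [IsNonarchimedeanLocalField F] in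
/-- Units of valuation subring from `valuation = 1`. [folklore] -/
theorem exists_units_coe_eq {x : Fˣ} (hx : valuation F (x : F) = 1) :
    ∃ u : 𝒪[F]ˣ, (((u : 𝒪[F]) : F)) = x := by
  have hmem : (x : F) ∈ 𝒪[F] := by
    change valuation F (x : F) ≤ 1
    exact hx.le
  have hunit : IsUnit (⟨(x : F), hmem⟩ : 𝒪[F]) :=
    (Valuation.integer.integers (valuation F)).isUnit_of_one' (x := ⟨(x : F), hmem⟩) (by exact hx)
  exact ⟨hunit.unit, rfl⟩

variable {art : WeilGroup F →* Fˣ} (hart : IsLocalArtinMap F art)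

include hart in
/-- On inertia the Artin map takes values in `𝒪_Fˣ`. [cite: SerreLocalFields1979, Ch. XIII §4 Prop. 13] -/
theorem exists_units_coe_eq_artin {w : WeilGroup F} (hw : w ∈ WeilGroup.inertia F) :
    ∃ u : 𝒪[F]ˣ, ((u : 𝒪[F]) : F) = art w := by
  have hwU : art w ∈ (valuation F).valuationSubring.unitGroup := by
    rw [← hart.image_inertia]; exact Subgroup.mem_map_of_mem _ hw
  exact exists_units_coe_eq ((Valuation.mem_unitGroup_iff _ _ _).mp hwU)

include hart in
/-- A geometric Frobenius of `W_F` with PRESCRIBED uniformiser under the Artin map (adjust any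
degree-`-1` element by inertia, `art(I_F) = 𝒪_Fˣ`). [cite: SerreLocalFields1979, Ch. XIII §4 Thm. 2] -/
theorem exists_deg_eq_neg_one_artin_eq {x : Fˣ} (hx : (valuation F).IsUniformizer (x : F)) :
    ∃ Φ : WeilGroup F, WeilGroup.deg Φ = -1 ∧ art Φ = x := by
  obtain ⟨Φ₀, hΦ₀⟩ := WeilGroup.deg_surjective IsFrobPow.mul_holds IsFrobPow.unique_holds
    (exists_isFrobPow_holds F) (-1 : ℤ)
  have h₀ := hart.artin_frob Φ₀ hΦ₀
  have hv : valuation F ((x * (art Φ₀)⁻¹ : Fˣ) : F) = 1 := by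
    rw [Units.val_mul, Units.val_inv_eq_inv_val, map_mul, map_inv₀, hx, h₀,
      mul_inv_cancel₀ (hx ▸ hx.val_ne_zero)]
  have hmem : x * (art Φ₀)⁻¹ ∈ (WeilGroup.inertia F).map art := by
    rw [hart.image_inertia]; exact (Valuation.mem_unitGroup_iff _ _ _).mpr hv
  obtain ⟨i, hi, hiart⟩ := Subgroup.mem_map.mp hmem
  refine ⟨i * Φ₀, ?_, ?_⟩
  · rw [WeilGroup.deg_mul IsFrobPow.mul_holds IsFrobPow.unique_holds,
      (WeilGroup.deg_eq_zero_iff_mem_inertia IsFrobPow.mul_holds IsFrobPow.unique_holds).mpr hi, hΦ₀,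
      zero_add]
  · rw [map_mul, hiart, inv_mul_cancel_right]

include hart in
/-- **Norm clause for the Lubin–Tate fields**: an element of `W_F` whose Artin image is `π` fixes
`K_π^{n+1}` pointwise (`π = N(-λ_{n+1})`). [cite: CasselsFrohlichANT1967, Ch. VI §3.7 Lemma 2 with
SerreLocalFields1979, Ch. XIII §4 Thm. 2] -/
theorem toAbsGalois_mem_fixingSubgroup_ltField {Φ : WeilGroup F}
    (hΦ : art Φ = Units.mk0 (π : F) (hπ.ne_zero)) (n : ℕ) :
    WeilGroup.toAbsGalois F Φ ∈ (ltField π n).fixingSubgroup := by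
  haveI := isAbelianGalois_ltField hπ n
  exact (hart.artin_mem_range_norm_iff (ltField π n) Φ).mp (hΦ ▸ mem_range_norm_ltField π hπ hπ.ne_zero n)

include hart in
/-- **Lubin–Tate reciprocity in the tree's (Deligne) normalisation**: for `w` in the inertia group
of `W_F`, the Lubin–Tate character of `w` IS its Artin image: `χ_π(w) = Art_F(w) ∈ 𝒪_Fˣ`, i.e.
`w` acts on every `π`-power division point `λ` of `F_f` by `w λ = [Art_F(w)]_f λ`.  (Printed with the
arithmetic normalisation `(u, F_π/F) = [u⁻¹]_f`: Lubin–Tate 1965 Thm. 3 / Cassels–Fröhlich VI §3.7;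
the tree's `IsLocalArtinMap` sends GEOMETRIC Frobenii to uniformisers, which inverts the sign.)
Proof (Lubin–Tate): pick `Φ` of degree `-1` with `Art(Φ) = π`; `w' = wΦ` has `Art(w') = uπ =: π'`,
so fixes the `f'`-division points (`f' ∈ 𝔉_{π'}`, norm clause); with `ϑ : F_f ≅ F_{f'}` over
`𝒪̂_{F^nr}` (`ϑ^φ = ϑ ∘ [u]_f`) and `μ = ϑ(λ)`: `μ = w'μ = ϑ^{φ⁻¹}(w'λ)` forces `w'λ = [u]_f λ`, and
`w'λ = wλ` as `Φ` fixes `K_π^{n+1}`.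
[cite: LubinTate1965, Thm. 3 and Cor. p. 386; CasselsFrohlichANT1967, Ch. VI §3.7 Thm. 3] -/
theorem coe_lubinTateChar_toAbsGalois {w : WeilGroup F} (hw : w ∈ WeilGroup.inertia F) :
    (((lubinTateChar hπ (WeilGroup.toAbsGalois F w) : 𝒪[F]ˣ) : 𝒪[F]) : F) = art w := by
  classical
  obtain ⟨u, hu⟩ := exists_units_coe_eq_artin hart hw
  -- a geometric Frobenius with `Art Φ = π`, and `w' = w Φ`
  obtain ⟨Φ, hΦdeg, hΦart⟩ := exists_deg_eq_neg_one_artin_eq hart (x := Units.mk0 (π : F) hπ.ne_zero) hπ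
  set w' := w * Φ with hw'
  have hπ' := isUniformizer_unit_mul hπ u
  have hw'deg : WeilGroup.deg w' = -1 := by
    rw [hw', WeilGroup.deg_mul IsFrobPow.mul_holds IsFrobPow.unique_holds,
      (WeilGroup.deg_eq_zero_iff_mem_inertia IsFrobPow.mul_holds IsFrobPow.unique_holds).mpr hw, hΦdeg,
      zero_add]
  have hw'art : art w' = Units.mk0 ((((u : 𝒪[F]) * π : 𝒪[F]) : F)) hπ'.ne_zero := by
    refine Units.ext ?_
    rw [hw', map_mul, Units.val_mul, hΦart, ← hu]
    rfl
  -- `w'` fixes the `f'`-division fields, `Φ` the `f`-division fields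
  have hfix' := toAbsGalois_mem_fixingSubgroup_ltField hπ' hart hw'art
  have hfix := toAbsGalois_mem_fixingSubgroup_ltField hπ hart hΦart
  -- `σ₀ = w'⁻¹` is an arithmetic Frobenius
  set σ₀ := (WeilGroup.toAbsGalois F w')⁻¹ with hσ₀def
  have hσ₀ : IsAbsArithFrob σ₀ := by
    have h := (WeilGroup.isFrobPow_deg IsFrobPow.mul_holds w').inv
    rw [hw'deg, neg_neg] at h
    exact isFrobPow_one_iff_isAbsArithFrob_holds.mp h
  obtain ⟨ε, hε⟩ := exists_unit_galAut_eq_mul hσ₀ u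
  -- level-by-level
  suffices hmain : ∀ n, π ^ (n + 1) ∣ (lubinTateChar hπ (WeilGroup.toAbsGalois F w) : 𝒪[F]) - (u : 𝒪[F]) by
    rw [eq_of_forall_pow_dvd_sub hπ hmain, hu]
  intro n
  set ϑ := compSeriesC hπ hσ₀ u hε with hϑ
  have hϑ0 := constantCoeff_compSeriesC hπ hσ₀ u hε
  set x := genPtC hπ n with hx
  set μ := evalPt₁ (maxNilIdealC F) ϑ hϑ0 x with hμ
  -- `μ` is an `f'`-division point of level `n+1`
  have hμtors : Polynomial.aeval ((μ : CBall F) : CompletedAlgClosure F)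
      ((ltPolyIter F ((u : 𝒪[F]) * π) (n + 1)).map (algebraMap 𝒪[F] F)) = 0 := by
    rw [← coe_evalPt₁_homC_pow hπ' (n + 1) μ]
    have h1 : evalPt₁ (maxNilIdealC F) (homC hπ' (((u : 𝒪[F]) * π) ^ (n + 1))) (constantCoeff_homC hπ' _) μ =
        evalPt₁ (maxNilIdealC F) (homC' hπ u ((u : 𝒪[F]) ^ (n + 1) * π ^ (n + 1)))
          (constantCoeff_homC' hπ u _) μ :=
      evalPt_congr _ (by rw [mul_pow]; rfl) _ _ _
    have h2 : evalPt₁ (maxNilIdealC F) (homC hπ (π ^ (n + 1))) (constantCoeff_homC hπ _) x = 0 := by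
      rw [hx, evalPt₁_homC_genPtC, ltAct_pow_succ_genPt]
      apply Subtype.ext
      change unitBallToCBall (ltField π n) ((0 : (maxNilIdeal F (ltField π n)).toIdeal) : unitBall (ltField π n)) = 0
      exact map_zero _
    rw [h1, evalPt₁_homC'_mul, hμ, ← evalPt₁_compSeriesC_homC, h2, evalPt₁_zero, evalPt₁_zero]
    rfl
  obtain ⟨y, hy⟩ := exists_algClosureToC_eq_of_aeval_eq_zero hπ' n hμtors
  -- hence fixed by `w'`
  have hfixμ : galCBall (WeilGroup.toAbsGalois F w') (μ : CBall F) = μ := by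
    have hyfix : WeilGroup.toAbsGalois F w' • (y : AlgebraicClosure F) = y :=
      (IntermediateField.mem_fixingSubgroup_iff _ _).mp (hfix' n) _ y.2
    apply Subtype.ext
    rw [coe_galCBall, ← hy, smul_algClosureToC, hyfix]
  -- semilinearity: `w' μ = ϑ^{φ⁻¹}(w' x)`; and `ϑ^{φ⁻¹} ∘ [u] = ϑ`
  have hsemi := galCBall_evalPt₁ (WeilGroup.toAbsGalois F w') ϑ hϑ0 x
  set x' : (maxNilIdealC F).toIdeal := ⟨galCBall (WeilGroup.toAbsGalois F w') x, galCBall_mem x.2⟩ with hx'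
  -- z = [u⁻¹](w' x) has [u] z = w' x
  set z := evalPt₁ (maxNilIdealC F) (homC hπ ((u⁻¹ : 𝒪[F]ˣ) : 𝒪[F])) (constantCoeff_homC hπ _) x' with hz
  have huz : evalPt₁ (maxNilIdealC F) (homC hπ (u : 𝒪[F])) (constantCoeff_homC hπ _) z = x' := by
    rw [hz, ← evalPt₁_homC_mul, Units.mul_inv, evalPt₁_homC_one]
  have hinv : WeilGroup.toAbsGalois F w' = σ₀⁻¹ := by rw [hσ₀def, inv_inv]
  have hser_eq : PowerSeries.map (unrGal σ₀⁻¹) (compSeriesC hπ hσ₀ u hε) =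
      PowerSeries.map (unrGal (WeilGroup.toAbsGalois F w')) (compSeriesC hπ hσ₀ u hε) := by rw [hinv]
  have hkey : evalPt₁ (maxNilIdealC F) ϑ hϑ0 z = μ := by
    rw [← evalPt₁_map_unrGal_inv_compSeriesC hπ hσ₀ u hε z, huz]
    apply Subtype.ext
    rw [← hfixμ, hμ, hsemi]
    exact congrArg Subtype.val (evalPt_congr (maxNilIdealC F) hser_eq _ _ (fun _ => x'))
  have hzx : z = x := evalPt₁_injective ϑ hϑ0 (isUnit_coeff_one_compSeriesC hπ hσ₀ u hε) hkey
  -- so `w' x = [u] x`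
  have hwx : x' = evalPt₁ (maxNilIdealC F) (homC hπ (u : 𝒪[F])) (constantCoeff_homC hπ _) x := by
    rw [← huz, hzx]
  -- read off in `F̄`
  have hF : WeilGroup.toAbsGalois F w •
      ((((genPt hπ n : (maxNilIdeal F (ltField π n)).toIdeal) : unitBall (ltField π n)) : ltField π n) :
        AlgebraicClosure F) =
      ((((ltAct hπ n (u : 𝒪[F]) (genPt hπ n) : (maxNilIdeal F (ltField π n)).toIdeal) :
        unitBall (ltField π n)) : ltField π n) : AlgebraicClosure F) := by
    apply (algClosureToC F).injective
    have h := congrArg (fun t : (maxNilIdealC F).toIdeal => ((t : CBall F) : CompletedAlgClosure F)) hwx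
    rw [evalPt₁_homC_genPtC] at h
    dsimp only at h
    change WeilGroup.toAbsGalois F w' • (((genPtC hπ n : (maxNilIdealC F).toIdeal) : CBall F) : CompletedAlgClosure F) = _ at h
    rw [coe_unitBallToCBall] at h
    rw [← h]
    change _ = WeilGroup.toAbsGalois F (w * Φ) • algClosureToC F _
    have hlamfix : WeilGroup.toAbsGalois F Φ •
        ((((genPt hπ n : (maxNilIdeal F (ltField π n)).toIdeal) : unitBall (ltField π n)) : ltField π n) :
          AlgebraicClosure F) = _ :=
      (IntermediateField.mem_fixingSubgroup_iff _ _).mp (hfix n) _ (genPt hπ n).1.1.2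
    rw [map_mul, mul_smul, smul_algClosureToC, hlamfix, smul_algClosureToC]
  -- compare with the defining property of `χ_π`
  have hχ := absGal_smul_ltAct_lubinTateChar hπ (WeilGroup.toAbsGalois F w) n 1
  rw [ltAct_one, mul_one, hF] at hχ
  refine (ltAct_genPt_eq_iff hπ).mp ?_
  exact (Subtype.ext (Subtype.ext (Subtype.ext hχ))).symm

include hπ in
/-- **`χ_π = Art_F` on inertia for THE Artin map of the tree** (`canonicalArtin F`, which has the
characterising clauses unconditionally: `isLocalArtinMap_canonicalArtin_holds`).
[cite: LubinTate1965, Thm. 3 and Cor. p. 386; CasselsFrohlichANT1967, Ch. VI §3.7 Thm. 3] -/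
theorem coe_lubinTateChar_toAbsGalois_canonicalArtin {w : WeilGroup F} (hw : w ∈ WeilGroup.inertia F) :
    (((lubinTateChar hπ (WeilGroup.toAbsGalois F w) : 𝒪[F]ˣ) : 𝒪[F]) : F) = canonicalArtin F w :=
  coe_lubinTateChar_toAbsGalois hπ (isLocalArtinMap_canonicalArtin_holds F) hw

/-- **Action of inertia on the division points through the Artin map**: for `w ∈ I_F` and every
`b ∈ 𝒪_F`, `w · [b]_f λ_{n+1} = [Art_F(w) · b]_f λ_{n+1}` (THE Artin map of the tree).
[cite: LubinTate1965, Thm. 3 (proof, p. 386); CasselsFrohlichANT1967, Ch. VI §3.7 Thm. 3 (b)] -/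
theorem toAbsGalois_smul_ltAct_genPt {w : WeilGroup F} (hw : w ∈ WeilGroup.inertia F) (n : ℕ) (b : 𝒪[F]) :
    WeilGroup.toAbsGalois F w •
        ((((ltAct hπ n b (genPt hπ n) : (maxNilIdeal F (ltField π n)).toIdeal) :
          unitBall (ltField π n)) : ltField π n) : AlgebraicClosure F) =
      ((((ltAct hπ n ((lubinTateChar hπ (WeilGroup.toAbsGalois F w) : 𝒪[F]) * b) (genPt hπ n) :
          (maxNilIdeal F (ltField π n)).toIdeal) : unitBall (ltField π n)) : ltField π n) :
        AlgebraicClosure F) ∧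
      (((lubinTateChar hπ (WeilGroup.toAbsGalois F w) : 𝒪[F]ˣ) : 𝒪[F]) : F) = canonicalArtin F w :=
  ⟨absGal_smul_ltAct_lubinTateChar hπ _ n b, coe_lubinTateChar_toAbsGalois_canonicalArtin hπ hw⟩

/-- **All Lubin–Tate characters of `F` agree on inertia**: `χ_π(w) = χ_{π'}(w)` for `w ∈ I_F`
and any two uniformisers (both equal `Art_F(w)`). [cite: CasselsFrohlichANT1967, Ch. VI §3.7 Cor.] -/
theorem lubinTateChar_toAbsGalois_eq_of_mem_inertia {π' : 𝒪[F]}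
    (hπ' : (valuation F).IsUniformizer (π' : F)) {w : WeilGroup F} (hw : w ∈ WeilGroup.inertia F) :
    lubinTateChar hπ (WeilGroup.toAbsGalois F w) = lubinTateChar hπ' (WeilGroup.toAbsGalois F w) := by
  refine Units.ext (Subtype.ext ?_)
  rw [coe_lubinTateChar_toAbsGalois_canonicalArtin hπ hw,
    coe_lubinTateChar_toAbsGalois_canonicalArtin hπ' hw]

end Reciprocity

end Points

end Literature.NumberTheory.GaloisRepresentations

end
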